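import Summits.AtomisticToContinuum.Crystallization.Theorems.BrittleRungDescentMieRungPeriodic
import Summits.AtomisticToContinuum.Crystallization.Theorems.ThreeConeCertificateKeplerBoundLocLimBlock

/-!
# Route `BrittleRungDescent`, item `MieRung` (stmt-AtomisticToContinuum-10946): the energetic
# conjunct for a general Lennard-Jones-like pair potential, III — matched environments

Part III of the generic-`V` series (hypotheses as in part I, `BrittleRungDescentMieRungPeriodic`).
Deterministic bookkeeping about ONE finite `δ`-separated configuration `y : Fin N → ℝ³` two-way
`ε`-matched, on a ball, with a `δ`-separated periodic configuration `P` — the generic-`V` versions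
of `KeplerBoundBulk.sum_lennardJones_far_ge`, `….siteEnergy_ge_of_matchedAt`,
`….siteSum_le_sum_near` and of `KeplerBoundLocalLimit.siteEnergy_ge_of_near`,
`….sum_siteEnergy_block_ge`, `….sum_sum_block_le` (the matching injection `exists_matching`, the
comparison `siteEnergy_ge_of_matching`, the packing count `card_near_le` and the block site sums
`sum_siteSum_bpt` of those files are already potential-independent and are reused):

* `sum_far_ge` — the far terms of a site energy sum to `≥ −A ρ⁻¹ · 250 r⁻⁵` (uniformly in `N`);
* `siteEnergy_ge_of_matchedAt` — the site energy of a matched particle is at least the truncated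
  site sum of `P` minus `#T·ω` minus the far floor;
* `siteSum_le_sum_near` — the site sum of `P` is at most its truncation at radius `R ≥ 1`;
* `siteEnergy_ge_of_near`, `sum_siteEnergy_block_ge`, `sum_sum_block_le` — the same summed over
  a block of `P` matched inside `y`.

All `[folklore]`.
-/

noncomputable section

namespace Summit.AtomisticToContinuum.Crystallization.Theorems.MieRungEnergetic

open Literature.MathematicalPhysics.StatisticalMechanics
open Summit.AtomisticToContinuum.Crystallization.Theorems.ChargedEnergyGapNegative
open Summit.AtomisticToContinuum.Crystallization.Theorems.ChargedEnergyGapNegative.Blocks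
open Summit.AtomisticToContinuum.Crystallization.Theorems.KeplerBoundBulk
  (exists_matching siteEnergy_ge_of_matching)
open Summit.AtomisticToContinuum.Crystallization.Theorems.KeplerBoundLocalLimit
  (card_near_le sum_siteSum_bpt)
open Filter Set Metric
open scoped BigOperators

variable {V : ℝ → ℝ} {A : ℝ}

/-! ### Uniform tails over separated configurations -/

/-- **The far terms are almost non-negative**: in an `r`-separated configuration, for `ρ > 0`,
`Σ_{k ≠ i, |x i − x k| > ρ} V(|x i − x k|) ≥ −A ρ⁻¹ · 250 r⁻⁵` (`V ≥ −A r⁻⁶` termwise, and the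
far sixth-power sum is `≤ 250 r⁻⁵ ρ⁻¹`, `ChargedPeriodicOptimal.sum_inv_pow_six_far_le`).
[folklore] -/
theorem sum_far_ge (h6 : ∀ r, 0 < r → -(A * r⁻¹ ^ 6) ≤ V r) (hA : 0 ≤ A) {N : ℕ}
    (x : Fin N → E3) {r : ℝ} (hr : 0 < r) (hsep : ∀ k l, k ≠ l → r ≤ dist (x k) (x l))
    (i : Fin N) {ρ : ℝ} (hρ : 0 < ρ) :
    -(A * (ρ⁻¹ * (250 * r⁻¹ ^ 5))) ≤
      ∑ k ∈ (Finset.univ.erase i).filter (fun k => ρ < dist (x i) (x k)),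
        V (dist (x i) (x k)) := by
  have hsix : ∑ k ∈ (Finset.univ.erase i).filter (fun k => ρ < dist (x i) (x k)),
      (dist (x i) (x k))⁻¹ ^ 6 ≤ ρ⁻¹ * (250 * r⁻¹ ^ 5) :=
    calc ∑ k ∈ (Finset.univ.erase i).filter (fun k => ρ < dist (x i) (x k)), (dist (x i) (x k))⁻¹ ^ 6
        ≤ ∑ k ∈ (Finset.univ.erase i).filter (fun k => ρ ≤ dist (x i) (x k)),
            (dist (x i) (x k))⁻¹ ^ 6 :=
          Finset.sum_le_sum_of_subset_of_nonneg
            (fun k hk => Finset.mem_filter.2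
              ⟨(Finset.mem_filter.1 hk).1, (Finset.mem_filter.1 hk).2.le⟩)
            fun k _ _ => by positivity
      _ ≤ 250 * r⁻¹ ^ 5 * ρ⁻¹ := ChargedPeriodicOptimal.sum_inv_pow_six_far_le x hr hsep i hρ
      _ = ρ⁻¹ * (250 * r⁻¹ ^ 5) := by ring
  have hterm : ∀ k ∈ (Finset.univ.erase i).filter (fun k => ρ < dist (x i) (x k)),
      -(A * (dist (x i) (x k))⁻¹ ^ 6) ≤ V (dist (x i) (x k)) := fun k hk =>
    h6 _ (hρ.trans (Finset.mem_filter.1 hk).2)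
  calc -(A * (ρ⁻¹ * (250 * r⁻¹ ^ 5)))
      ≤ -(A * ∑ k ∈ (Finset.univ.erase i).filter (fun k => ρ < dist (x i) (x k)),
          (dist (x i) (x k))⁻¹ ^ 6) := by nlinarith
    _ = ∑ k ∈ (Finset.univ.erase i).filter (fun k => ρ < dist (x i) (x k)),
          -(A * (dist (x i) (x k))⁻¹ ^ 6) := by
        rw [Finset.mul_sum, ← Finset.sum_neg_distrib]
    _ ≤ _ := Finset.sum_le_sum hterm

/-! ### The site energy of a matched particle -/

/-- **Site energy of a matched particle.** If the `R`-environment of the particle `x i` of a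
`δ`-separated configuration is two-way `ε`-matched to `x i + 𝔄 (P.points − y)` (`y` a point of
the `δ`-separated periodic configuration `P`, `𝔄` a linear isometry, `2ε < δ`, `ε ≤ 1`, `R ≥ 2`)
and `ω` is a modulus of continuity of `V` on `[δ, R + 1]` at scale `ε`, then
`siteEnergy V x i ≥ Σ_{q ∈ T} V(dist q y) − #T·ω − A (R − 1)⁻¹ · 250 δ⁻⁵`,
`T = {q ∈ P.points : q ≠ y, dist q y ≤ R}`. [folklore] -/
theorem siteEnergy_ge_of_matchedAt (hfar : ∀ r, 1 ≤ r → V r ≤ 0)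
    (h6 : ∀ r, 0 < r → -(A * r⁻¹ ^ 6) ≤ V r) (hA : 0 ≤ A)
    {P : PeriodicConfiguration 3} {y : E3} {R ε δ ω : ℝ} {N : ℕ}
    {x : Fin N → E3} {i : Fin N} {𝔄 : E3 →ₗᵢ[ℝ] E3} {T : Finset E3}
    (hT : ∀ q, q ∈ T ↔ q ∈ P.points ∧ q ≠ y ∧ dist q y ≤ R) (hy : y ∈ P.points)
    (ha : ∀ q ∈ P.points, dist q y ≤ R → ∃ j, dist (x j) (x i + 𝔄 (q - y)) ≤ ε)
    (hb : ∀ j, dist (x j) (x i) ≤ R → ∃ q ∈ P.points, dist (x j) (x i + 𝔄 (q - y)) ≤ ε)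
    (hxsep : ∀ k l, k ≠ l → δ ≤ dist (x k) (x l))
    (hPsep : ∀ p ∈ P.points, ∀ q ∈ P.points, p ≠ q → δ ≤ dist p q)
    (hδ : 0 < δ) (hε : 0 ≤ ε) (hεδ : 2 * ε < δ) (hε1 : ε ≤ 1) (hR : 2 ≤ R)
    (hω : ∀ s t : ℝ, δ ≤ s → δ ≤ t → s ≤ R + 1 → t ≤ R + 1 → |s - t| ≤ ε →
      |V s - V t| ≤ ω) :
    ∑ q ∈ T, V (dist q y) - T.card * ω - A * ((R - 1)⁻¹ * (250 * δ⁻¹ ^ 5)) ≤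
      siteEnergy V x i := by
  obtain ⟨φ, h1, h2, h3, h4⟩ := exists_matching hT hy ha hb hxsep hPsep hε hεδ
  have hρ : 0 < R - ε := by linarith
  have hω' : ∀ q ∈ T, |V (dist (x i) (x (φ q))) - V (dist q y)| ≤ ω := by
    intro q hq
    obtain ⟨hqP, hqy, hqR⟩ := (hT q).1 hq
    have hd := h3 q hq
    have hd' := abs_sub_le_iff.1 hd
    have ht : δ ≤ dist q y := hPsep q hqP y hy hqy
    have hs : δ ≤ dist (x i) (x (φ q)) := hxsep i (φ q) (h1 q hq).symm
    exact hω _ _ hs ht (by linarith [hd'.1]) (by linarith) hd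
  have hneg : ∀ k, k ≠ i → R - ε < dist (x i) (x k) → V (dist (x i) (x k)) ≤ 0 :=
    fun k _ hk => hfar _ (by linarith)
  have hmain := siteEnergy_ge_of_matching V x i φ (fun q => dist q y) h1 h2 hω' h4 hneg
  have hfar' := sum_far_ge h6 hA x hδ hxsep i hρ
  have hinv : (R - ε)⁻¹ ≤ (R - 1)⁻¹ := (inv_le_inv₀ hρ (by linarith)).2 (by linarith)
  have hC : 0 ≤ 250 * δ⁻¹ ^ 5 := by positivity
  have hmono : A * ((R - ε)⁻¹ * (250 * δ⁻¹ ^ 5)) ≤ A * ((R - 1)⁻¹ * (250 * δ⁻¹ ^ 5)) :=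
    mul_le_mul_of_nonneg_left (mul_le_mul_of_nonneg_right hinv hC) hA
  linarith

/-! ### Truncating the site sum of `P` from above -/

/-- **The site sum is at most its truncation** at any radius `R ≥ 1`: the dropped terms
`V(dist q y)`, `dist q y > R ≥ 1`, are non-positive and the family is summable. [folklore] -/
theorem siteSum_le_sum_near (hfar : ∀ r, 1 ≤ r → V r ≤ 0)
    (h6 : ∀ r, 0 < r → -(A * r⁻¹ ^ 6) ≤ V r) (hA : 0 ≤ A) (P : PeriodicConfiguration 3)
    {y : E3} {R : ℝ} (hR : 1 ≤ R) {T : Finset E3}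
    (hT : ∀ q, q ∈ T ↔ q ∈ P.points ∧ q ≠ y ∧ dist q y ≤ R) :
    siteSum P V y ≤ ∑ q ∈ T, V (dist q y) := by
  classical
  have hsum : Summable fun q : {q : E3 // q ∈ P.points ∧ q ≠ y} => V (dist y q.1) :=
    summable_dist hfar h6 hA P y
  set s : Finset {q : E3 // q ∈ P.points ∧ q ≠ y} := T.subtype fun q => q ∈ P.points ∧ q ≠ y
    with hs
  have hsplit := hsum.sum_add_tsum_compl (s := s)
  have htail : ∑' q : ((s : Set {q : E3 // q ∈ P.points ∧ q ≠ y})ᶜ : Set _),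
      V (dist y q.1.1) ≤ 0 := by
    refine tsum_nonpos fun q => hfar _ ?_
    have hq : ¬ (q.1.1 ∈ T) := fun h =>
      q.2 (Finset.mem_coe.2 (show q.1 ∈ T.subtype (fun q => q ∈ P.points ∧ q ≠ y) from
        Finset.mem_subtype.2 h))
    have hq' : ¬ dist q.1.1 y ≤ R := fun h => hq ((hT _).2 ⟨q.1.2.1, q.1.2.2, h⟩)
    rw [dist_comm]
    linarith [not_le.1 hq']
  have hfin : ∑ q ∈ s, V (dist y q.1) = ∑ q ∈ T, V (dist q y) := by
    have h3 := Finset.sum_subtype_eq_sum_filter (s := T) (fun q : E3 => V (dist y q))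
      (p := fun q => q ∈ P.points ∧ q ≠ y)
    rw [Finset.filter_true_of_mem (fun q hq => ⟨((hT q).1 hq).1, ((hT q).1 hq).2.1⟩)] at h3
    rw [hs, h3]
    exact Finset.sum_congr rfl fun q _ => by rw [dist_comm]
  unfold siteSum
  linarith

/-! ### One particle near a deep point of `P` (identity chart) -/

/-- **Site energy of a particle near a point of `P`.** If `y` and `P` are two-way `ε`-matched
on `‖·‖ ≤ L`, `p ∈ P.points` with `‖p‖ + t₀ + 1 ≤ L`, and the particle `y i` is within `ε` of
`p` (`4ε < δ`, `2ε ≤ 1`, `t₀ ≥ 2`, both `y` and `P` `δ`-separated), then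
`𝓔ⁱ(y) ≥ Σ_{q ∈ T} V(dist q p) − #T·ω − A (250 δ⁻⁵)/(t₀ − 1)` with
`T = {q ∈ P.points : q ≠ p, dist q p ≤ t₀}` and `ω` a modulus of `V` on `[δ, t₀ + 1]` at scale
`2ε`. [folklore] -/
theorem siteEnergy_ge_of_near (hfar : ∀ r, 1 ≤ r → V r ≤ 0)
    (h6 : ∀ r, 0 < r → -(A * r⁻¹ ^ 6) ≤ V r) (hA : 0 ≤ A) {P : PeriodicConfiguration 3}
    {p : E3} (hp : p ∈ P.points) {N : ℕ} {y : Fin N → E3} {i : Fin N}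
    {δ ε t₀ L ω : ℝ} {T : Finset E3}
    (hT : ∀ q, q ∈ T ↔ q ∈ P.points ∧ q ≠ p ∧ dist q p ≤ t₀)
    (hm1 : ∀ q ∈ P.points, ‖q‖ ≤ L → ∃ j, dist (y j) q ≤ ε)
    (hm2 : ∀ j, ‖y j‖ ≤ L → ∃ q ∈ P.points, dist (y j) q ≤ ε)
    (hL : ‖p‖ + t₀ + 1 ≤ L) (hi : dist (y i) p ≤ ε)
    (hsep : ∀ k l, k ≠ l → δ ≤ dist (y k) (y l))
    (hPsep : ∀ p ∈ P.points, ∀ q ∈ P.points, p ≠ q → δ ≤ dist p q)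
    (hδ : 0 < δ) (hε : 0 ≤ ε) (hεδ : 4 * ε < δ) (hε1 : 2 * ε ≤ 1) (ht₀ : 2 ≤ t₀)
    (hω : ∀ s t : ℝ, δ ≤ s → δ ≤ t → s ≤ t₀ + 1 → t ≤ t₀ + 1 → |s - t| ≤ 2 * ε →
      |V s - V t| ≤ ω) :
    ∑ q ∈ T, V (dist q p) - T.card * ω - A * ((t₀ - 1)⁻¹ * (250 * δ⁻¹ ^ 5)) ≤
      siteEnergy V y i := by
  have hip : dist p (y i) ≤ ε := by rwa [dist_comm] at hi
  set I : E3 →ₗᵢ[ℝ] E3 := LinearIsometry.id with hI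
  have hIapp : ∀ v : E3, I v = v := fun v => rfl
  have hshift : ∀ q : E3, dist q (y i + I (q - p)) ≤ ε := fun q => by
    rw [hIapp, dist_eq_norm]
    have e : q - (y i + (q - p)) = p - y i := by abel
    rw [e, ← dist_eq_norm]
    exact hip
  have ha : ∀ q ∈ P.points, dist q p ≤ t₀ → ∃ j, dist (y j) (y i + I (q - p)) ≤ 2 * ε := by
    intro q hq hqt
    have hqn : ‖q‖ ≤ L := by
      have h1 : ‖q‖ ≤ ‖q - p‖ + ‖p‖ := norm_le_norm_sub_add q p
      rw [← dist_eq_norm] at h1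
      linarith
    obtain ⟨j, hj⟩ := hm1 q hq hqn
    refine ⟨j, ?_⟩
    calc dist (y j) (y i + I (q - p))
        ≤ dist (y j) q + dist q (y i + I (q - p)) := dist_triangle _ _ _
      _ ≤ ε + ε := add_le_add hj (hshift q)
      _ = 2 * ε := by ring
  have hb : ∀ j, dist (y j) (y i) ≤ t₀ →
      ∃ q ∈ P.points, dist (y j) (y i + I (q - p)) ≤ 2 * ε := by
    intro j hj
    have hyi : ‖y i‖ ≤ ε + ‖p‖ := by
      have h1 : ‖y i‖ ≤ ‖y i - p‖ + ‖p‖ := norm_le_norm_sub_add (y i) p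
      rw [← dist_eq_norm] at h1
      linarith
    have hjn : ‖y j‖ ≤ L := by
      have h1 : ‖y j‖ ≤ ‖y j - y i‖ + ‖y i‖ := norm_le_norm_sub_add (y j) (y i)
      rw [← dist_eq_norm] at h1
      linarith
    obtain ⟨q, hq, hjq⟩ := hm2 j hjn
    refine ⟨q, hq, ?_⟩
    calc dist (y j) (y i + I (q - p))
        ≤ dist (y j) q + dist q (y i + I (q - p)) := dist_triangle _ _ _
      _ ≤ ε + ε := add_le_add hjq (hshift q)
      _ = 2 * ε := by ring
  exact siteEnergy_ge_of_matchedAt hfar h6 hA (ε := 2 * ε) hT hp ha hb hsep hPsep hδ (by linarith)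
    (by linarith) hε1 ht₀ hω

/-! ### The whole block -/

/-- **Site energies over a matched block.** With `i u` the particle within `ε` of `bpt u` and
every block point deep inside the matched ball,
`Σ_u 𝓔^{i u}(y) ≥ 2·#block·e_V(P) − #block·((2t₀/δ + 1)³ ω + A (250 δ⁻⁵)/(t₀ − 1))`.
[folklore] -/
theorem sum_siteEnergy_block_ge (hfar : ∀ r, 1 ≤ r → V r ≤ 0)
    (h6 : ∀ r, 0 < r → -(A * r⁻¹ ^ 6) ≤ V r) (hA : 0 ≤ A) {P : PeriodicConfiguration 3}
    {K : ℕ} {N : ℕ} {y : Fin N → E3} (i : BIdx P K → Fin N) {δ ε t₀ L ω : ℝ}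
    (hm1 : ∀ q ∈ P.points, ‖q‖ ≤ L → ∃ j, dist (y j) q ≤ ε)
    (hm2 : ∀ j, ‖y j‖ ≤ L → ∃ q ∈ P.points, dist (y j) q ≤ ε)
    (hL : ∀ u, ‖bpt P K u‖ + t₀ + 1 ≤ L) (hi : ∀ u, dist (y (i u)) (bpt P K u) ≤ ε)
    (hsep : ∀ k l, k ≠ l → δ ≤ dist (y k) (y l))
    (hPsep : ∀ p ∈ P.points, ∀ q ∈ P.points, p ≠ q → δ ≤ dist p q)
    (hδ : 0 < δ) (hε : 0 ≤ ε) (hεδ : 4 * ε < δ) (hε1 : 2 * ε ≤ 1) (ht₀ : 2 ≤ t₀) (hω0 : 0 ≤ ω)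
    (hω : ∀ s t : ℝ, δ ≤ s → δ ≤ t → s ≤ t₀ + 1 → t ≤ t₀ + 1 → |s - t| ≤ 2 * ε →
      |V s - V t| ≤ ω) :
    2 * (Fintype.card (BIdx P K) : ℝ) * P.energyPerParticle V -
        (Fintype.card (BIdx P K) : ℝ) *
          ((2 * t₀ / δ + 1) ^ 3 * ω + A * ((t₀ - 1)⁻¹ * (250 * δ⁻¹ ^ 5))) ≤
      ∑ u : BIdx P K, siteEnergy V y (i u) := by
  classical
  have hper : ∀ u : BIdx P K, siteSum P V (bpt P K u) -
      ((2 * t₀ / δ + 1) ^ 3 * ω + A * ((t₀ - 1)⁻¹ * (250 * δ⁻¹ ^ 5))) ≤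
        siteEnergy V y (i u) := by
    intro u
    set p := bpt P K u with hp_def
    have hp : p ∈ P.points := bpt_mem P K u
    have hfin : (closedBall p t₀ ∩ P.points).Finite := P.finite_inter_points isBounded_closedBall
    obtain ⟨T, hT⟩ : ∃ T : Finset E3, ∀ q, q ∈ T ↔ q ∈ P.points ∧ q ≠ p ∧ dist q p ≤ t₀ := by
      refine ⟨hfin.toFinset.erase p, fun q => ?_⟩
      rw [Finset.mem_erase, Set.Finite.mem_toFinset, Set.mem_inter_iff, mem_closedBall]
      constructor
      · rintro ⟨h1, h2, h3⟩; exact ⟨h3, h1, h2⟩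
      · rintro ⟨h1, h2, h3⟩; exact ⟨h2, h3, h1⟩
    have h1 := siteEnergy_ge_of_near hfar h6 hA hp hT hm1 hm2 (hL u) (hi u) hsep hPsep hδ hε hεδ
      hε1 ht₀ hω
    have h2 := siteSum_le_sum_near hfar h6 hA P (by linarith : (1 : ℝ) ≤ t₀) hT
    have h3 := card_near_le hT hPsep hδ (by linarith)
    have h4 : (T.card : ℝ) * ω ≤ (2 * t₀ / δ + 1) ^ 3 * ω := mul_le_mul_of_nonneg_right h3 hω0
    linarith
  have hsum := Finset.sum_le_sum fun u (_ : u ∈ Finset.univ) => hper u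
  rw [Finset.sum_sub_distrib, sum_siteSum_bpt, Finset.sum_const, Finset.card_univ, nsmul_eq_mul]
    at hsum
  exact hsum

/-- **Pair sums over a matched block.** If moreover `u ↦ i u` is injective and all block pair
distances are `≤ D`, then for a modulus `ω₂ ≥ 0` of `V` on `[δ, D + 1]` at scale `2ε`,
`Σ_u Σ_v V(|y (i u) − y (i v)|) ≤ 2·𝓔_V(blockConfig P K) + #block²·ω₂` (`V 0 = 0` for the
diagonal). [folklore] -/
theorem sum_sum_block_le (hV0 : V 0 = 0) {P : PeriodicConfiguration 3} {K : ℕ} {N : ℕ}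
    {y : Fin N → E3} (i : BIdx P K → Fin N) (hinj : Function.Injective i) {δ ε D ω₂ : ℝ}
    (hi : ∀ u, dist (y (i u)) (bpt P K u) ≤ ε)
    (hsep : ∀ k l, k ≠ l → δ ≤ dist (y k) (y l))
    (hPsep : ∀ p ∈ P.points, ∀ q ∈ P.points, p ≠ q → δ ≤ dist p q)
    (hε1 : 2 * ε ≤ 1) (hD : ∀ u v, dist (bpt P K u) (bpt P K v) ≤ D) (hω0 : 0 ≤ ω₂)
    (hω₂ : ∀ s t : ℝ, δ ≤ s → δ ≤ t → s ≤ D + 1 → t ≤ D + 1 → |s - t| ≤ 2 * ε →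
      |V s - V t| ≤ ω₂) :
    ∑ u : BIdx P K, ∑ v : BIdx P K, V (dist (y (i u)) (y (i v))) ≤
      2 * interactionEnergy V (blockConfig P K) +
        (Fintype.card (BIdx P K) : ℝ) ^ 2 * ω₂ := by
  rw [two_mul_energy_blockConfig P K hV0]
  have hterm : ∀ u v : BIdx P K, V (dist (y (i u)) (y (i v))) ≤
      V (dist (bpt P K u) (bpt P K v)) + ω₂ := by
    intro u v
    by_cases huv : u = v
    · subst huv
      rw [dist_self, dist_self]
      linarith
    · have hne : i u ≠ i v := fun h => huv (hinj h)
      have hne' : bpt P K u ≠ bpt P K v := fun h => huv (bpt_injective P K h)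
      have hs : δ ≤ dist (y (i u)) (y (i v)) := hsep _ _ hne
      have ht : δ ≤ dist (bpt P K u) (bpt P K v) := hPsep _ (bpt_mem P K u) _ (bpt_mem P K v) hne'
      have hdiff : |dist (y (i u)) (y (i v)) - dist (bpt P K u) (bpt P K v)| ≤ 2 * ε := by
        have h1 := dist_dist_dist_le (y (i u)) (y (i v)) (bpt P K u) (bpt P K v)
        rw [Real.dist_eq] at h1
        linarith [hi u, hi v]
      have hd' := abs_sub_le_iff.1 hdiff
      have hbd := hD u v
      have := hω₂ _ _ hs ht (by linarith) (by linarith) hdiff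
      linarith [(abs_sub_le_iff.1 this).1]
  calc ∑ u : BIdx P K, ∑ v : BIdx P K, V (dist (y (i u)) (y (i v)))
      ≤ ∑ u : BIdx P K, ∑ v : BIdx P K, (V (dist (bpt P K u) (bpt P K v)) + ω₂) :=
        Finset.sum_le_sum fun u _ => Finset.sum_le_sum fun v _ => hterm u v
    _ = ∑ u : BIdx P K, ∑ v : BIdx P K, V (dist (bpt P K u) (bpt P K v)) +
          (Fintype.card (BIdx P K) : ℝ) ^ 2 * ω₂ := by
        simp only [Finset.sum_add_distrib, Finset.sum_const, Finset.card_univ, nsmul_eq_mul]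
        ring

end Summit.AtomisticToContinuum.Crystallization.Theorems.MieRungEnergetic

end
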